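import Mathlib
import HarnessLib
import Summits.HubbardSuperconductivity.HubbardSuperconductivity.Theorems.KLProgrammeKLRegimeTwoVolumeSubstitutionGluing

/-!
# Route `KLProgramme` — crux K3, the nested two-volume pass: the substitution–gluing defect AT A DEEP PIN is (tails of the substitution) × (pinned
# profile) + (column mass) × (far profile) — the SUMMED form of bracket (iv) (cell gate-hubbard-kl, seat hubbard-kl-k3c4-p1 g8; VL-STUB-ROUTE-A-g8.md §3,
# plan (R51); `--supports` stmt-…-20440)

`…TwoVolumeSubstitutionGluing.norm_kernel_map_glue_sub_glue_map_le` (p547014) bounds the kernels of `map T′ (Glue V) − Glue (map T V)` at an out-string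
`X′` by `Σ_Y ‖kernel V Y‖ · (T2 + T1 + T3)`: other-block lifts `T2 = Σ_{β ≠ β₀} ∏_i B(X′_i, β, Y_i)`, cross-block out-strings
`T1 = [X′ ⊄ β₀]·∏_i B(X′_i, β₀, Y_i)`, winding lifts `T3 = [X′ ⊂ β₀]·Σ_{βs ≠ const β₀} ∏_i B(X′_i, βs i, Y_i)`, with `B(x′, β, y) = ‖T′ x′ (e₁⁻¹(β, y))‖`
and `β₀` the block of the reference leg.  This file sums the three terms over the out-strings PINNED at a DEEP out-label `w′` (block `β₀`), for an
abstract nonnegative `B : Γ₂′ → ι → Γ₁ → ℝ`, block map `box : Γ₂′ → ι`, nonnegative in-string weights `k` (the `‖kernel V (n+1) ·‖`), and the data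

* column sums `Σ_{x′} B x′ β y ≤ a`, box-collapsed column sums `Σ_β Σ_{x′ ∈ β₀} B x′ β y ≤ a` (translation covariance), pin row in its box `Σ_y B w′ β₀ y ≤ a`;
* TAILS (all `≤ τ`): the pin's row outside its box `Σ_{β ≠ β₀} Σ_y B w′ β y`, the pin's row beyond the near region `Σ_{¬Near y} B w′ β₀ y`, and, for in-labels
  `y` OFF the zone `Z` (deep in block `β₀`), the column outside the box `Σ_{x′ ∉ β₀} B x′ β₀ y` and the winding columns `Σ_{β ≠ β₀} Σ_{x′ ∈ β₀} B x′ β y`;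
* geometry: a near in-label and a zone in-label are `Far`; profiles: pinned `Σ_{Y : Y_p = y} k Y ≤ N`, far `Σ_{Y : Y_p = y, Far (Y_p) (Y_i)} k Y ≤ Nfar`:

**`sum_pinned_otherBlock_le`** `(T2) ≤ aⁿ·τ·N`, **`sum_pinned_crossBlock_le`** `(T1) ≤ n·aⁿ·(2τN + a·Nfar)` (this file); `sum_pinned_winding_le`
`(T3) ≤ aⁿ·τ·N + n·aⁿ·(3τN + a·Nfar)` (companion `…TwoVolumeSubstitutionGluingWinding`); helpers (`sum_pinned_prod_eq` of p547014), `prod_le_pow_card_of_le`,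
`ite_forall_le_sum_indicator`, `sum_erase_const_le_sum_filter`, `sum_mul_apply_leg_eq/_le` (fibrewise in the pinned leg).  Everything is proved; no definition; model-free.
References: Salmhofer 1999 §2.6/§4.3 (finite-volume bookkeeping); BGM 2006 §2.7 (2.70)–(2.71a).
-/

noncomputable section

namespace Summit.HubbardSuperconductivity.HubbardSuperconductivity.Theorems.TwoVolumeDefect

set_option linter.dupNamespace false -- summit = problem name (single-conjunct summit), D-0017

open Finset Literature.MathematicalPhysics.QuantumLattice

section Generic

variable {ι Γ₁ Γ₂' : Type*} [Fintype ι] [DecidableEq ι] [Fintype Γ₁] [DecidableEq Γ₁] [Fintype Γ₂'] [DecidableEq Γ₂']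

/-! ## §1 Helpers: pinned sums of leg-wise products, powers, indicators, fibres of the pinned leg -/

omit [Fintype ι] [DecidableEq ι] [Fintype Γ₁] [DecidableEq Γ₁] [Fintype Γ₂'] [DecidableEq Γ₂'] in
/-- A product of `s.card` factors in `[0, a]` is at most `a ^ s.card`. [folklore] -/
theorem prod_le_pow_card_of_le {α : Type*} (s : Finset α) (g : α → ℝ) {a : ℝ} (h0 : ∀ i ∈ s, 0 ≤ g i) (h : ∀ i ∈ s, g i ≤ a) :
    ∏ i ∈ s, g i ≤ a ^ s.card := by
  calc ∏ i ∈ s, g i ≤ ∏ _i ∈ s, a := prod_le_prod h0 h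
    _ = a ^ s.card := prod_const a

omit [Fintype ι] [DecidableEq ι] [Fintype Γ₁] [DecidableEq Γ₁] [Fintype Γ₂'] [DecidableEq Γ₂'] in
/-- `card (univ.erase p) = n` in `Fin (n+1)`. [folklore] -/
theorem card_univ_erase_fin {n : ℕ} (p : Fin (n + 1)) : (univ.erase p).card = n := by
  rw [card_erase_of_mem (mem_univ p), card_univ, Fintype.card_fin, Nat.add_sub_cancel]

omit [Fintype ι] [DecidableEq ι] [Fintype Γ₁] [DecidableEq Γ₁] [Fintype Γ₂'] [DecidableEq Γ₂'] in
/-- `card ((univ.erase p).erase i) + 1 = n` for `i ≠ p` in `Fin (n+1)`. [folklore] -/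
theorem card_univ_erase_erase_fin {n : ℕ} {p i : Fin (n + 1)} (hi : i ∈ univ.erase p) : ((univ.erase p).erase i).card + 1 = n := by
  rw [card_erase_of_mem hi, card_univ_erase_fin]
  have : 1 ≤ n := by
    have h := card_pos.2 ⟨i, hi⟩
    rw [card_univ_erase_fin] at h
    exact h
  omega

omit [Fintype ι] [Fintype Γ₁] [DecidableEq Γ₁] [Fintype Γ₂'] [DecidableEq Γ₂'] in
/-- **Cross-block indicator ≤ sum of the per-leg indicators** (the reference leg is in the block): for `P ≥ 0`,
`[¬ ∀ i, box X′_i = β₀]·P ≤ Σ_{i ≠ p} [box X′_i ≠ β₀]·P`. [folklore] -/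
theorem ite_forall_le_sum_indicator {m : ℕ} (box : Γ₂' → ι) (β₀ : ι) (X' : Fin m → Γ₂') (p : Fin m) (hp : box (X' p) = β₀)
    {P : ℝ} (hP : 0 ≤ P) :
    (if ∀ i, box (X' i) = β₀ then 0 else P) ≤ ∑ i ∈ univ.erase p, if box (X' i) = β₀ then 0 else P := by
  split_ifs with h
  · exact sum_nonneg fun i _ => ite_nonneg le_rfl hP
  · push Not at h
    obtain ⟨i, hi⟩ := h
    have hip : i ∈ univ.erase p := mem_erase.2 ⟨fun h' => hi (h' ▸ hp), mem_univ i⟩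
    calc P = (if box (X' i) = β₀ then 0 else P) := by rw [if_neg hi]
      _ ≤ ∑ j ∈ univ.erase p, (if box (X' j) = β₀ then 0 else P) :=
          single_le_sum (f := fun j => if box (X' j) = β₀ then (0 : ℝ) else P) (fun j _ => ite_nonneg le_rfl hP) hip

omit [Fintype Γ₁] [DecidableEq Γ₁] [Fintype Γ₂'] [DecidableEq Γ₂'] in
/-- **Winding indicator ≤ sum of the per-leg indicators**: for `g ≥ 0`, `Σ_{βs ≠ const β₀} g βs ≤ Σ_i Σ_{βs : βs i ≠ β₀} g βs`. [folklore] -/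
theorem sum_erase_const_le_sum_filter {m : ℕ} (g : (Fin m → ι) → ℝ) (hg : ∀ βs, 0 ≤ g βs) (β₀ : ι) :
    ∑ βs ∈ univ.erase (fun _ : Fin m => β₀), g βs ≤ ∑ i : Fin m, ∑ βs ∈ univ.filter (fun βs : Fin m → ι => βs i ≠ β₀), g βs := by
  classical
  calc ∑ βs ∈ univ.erase (fun _ : Fin m => β₀), g βs
      ≤ ∑ βs ∈ univ.erase (fun _ : Fin m => β₀), ∑ i : Fin m, (if βs i ≠ β₀ then g βs else 0) := by
        refine sum_le_sum fun βs hβs => ?_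
        obtain ⟨i, hi⟩ : ∃ i, βs i ≠ β₀ := by
          by_contra h
          push Not at h
          exact (mem_erase.1 hβs).1 (funext h)
        calc g βs = (if βs i ≠ β₀ then g βs else 0) := by rw [if_pos hi]
          _ ≤ ∑ j : Fin m, (if βs j ≠ β₀ then g βs else 0) :=
              single_le_sum (f := fun j => if βs j ≠ β₀ then g βs else 0) (fun j _ => ite_nonneg (hg βs) le_rfl) (mem_univ i)
    _ ≤ ∑ βs, ∑ i : Fin m, (if βs i ≠ β₀ then g βs else 0) :=
        sum_le_sum_of_subset_of_nonneg (erase_subset _ _) fun βs _ _ =>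
          sum_nonneg fun i _ => ite_nonneg (hg βs) le_rfl
    _ = ∑ i : Fin m, ∑ βs ∈ univ.filter (fun βs : Fin m → ι => βs i ≠ β₀), g βs := by
        rw [sum_comm]
        exact sum_congr rfl fun i _ => (sum_filter _ _).symm

omit [Fintype ι] [DecidableEq ι] [Fintype Γ₂'] [DecidableEq Γ₂'] in
/-- **Fibrewise in the pinned leg**: `Σ_Y k(Y)·g(Y_p) = Σ_y g(y)·Σ_{Y : Y_p = y} k(Y)`. [folklore] -/
theorem sum_mul_apply_leg_eq {m : ℕ} (k : (Fin m → Γ₁) → ℝ) (g : Γ₁ → ℝ) (p : Fin m) :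
    ∑ Y : Fin m → Γ₁, k Y * g (Y p) = ∑ y : Γ₁, g y * ∑ Y ∈ univ.filter (fun Y : Fin m → Γ₁ => Y p = y), k Y := by
  rw [← sum_fiberwise univ (fun Y : Fin m → Γ₁ => Y p) (fun Y => k Y * g (Y p))]
  refine sum_congr rfl fun y _ => ?_
  rw [mul_sum]
  refine sum_congr rfl fun Y hY => ?_
  rw [(mem_filter.1 hY).2, mul_comm]

omit [Fintype ι] [DecidableEq ι] [Fintype Γ₂'] [DecidableEq Γ₂'] in
/-- A pinned-leg weighted sum against a profile bound: `g ≥ 0`, `Σ_{Y : Y_p = y} k ≤ N` ⇒ `Σ_Y k(Y) g(Y_p) ≤ (Σ_y g y)·N`. [folklore] -/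
theorem sum_mul_apply_leg_le {m : ℕ} (k : (Fin m → Γ₁) → ℝ) (g : Γ₁ → ℝ) (hg : ∀ y, 0 ≤ g y) (p : Fin m) {N : ℝ}
    (hN : ∀ y, ∑ Y ∈ univ.filter (fun Y : Fin m → Γ₁ => Y p = y), k Y ≤ N) :
    ∑ Y : Fin m → Γ₁, k Y * g (Y p) ≤ (∑ y, g y) * N := by
  rw [sum_mul_apply_leg_eq, sum_mul]
  exact sum_le_sum fun y _ => mul_le_mul_of_nonneg_left (hN y) (hg y)

/-! ## §2 (T2): other-block lifts -/

/-- **(T2) OTHER-BLOCK LIFTS at a deep pin**: `Σ_{X′ : X′_p = w′} Σ_Y k(Y)·Σ_{β ≠ β₀} ∏_i B(X′_i, β, Y_i) ≤ aⁿ·τ·N` — the pinned factor is the pin's row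
OUTSIDE its box (`≤ τ` after summing the in-label), every other leg a column sum (`≤ a`). [folklore] -/
theorem sum_pinned_otherBlock_le {n : ℕ} (B : Γ₂' → ι → Γ₁ → ℝ) (hB : ∀ x β y, 0 ≤ B x β y) (k : (Fin (n + 1) → Γ₁) → ℝ)
    (hk : ∀ Y, 0 ≤ k Y) (p : Fin (n + 1)) (w' : Γ₂') (β₀ : ι) {a τ N : ℝ} (ha : 0 ≤ a) (hN0 : 0 ≤ N)
    (hcol : ∀ β y, ∑ x, B x β y ≤ a) (hτ : ∑ β ∈ univ.erase β₀, ∑ y, B w' β y ≤ τ)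
    (hN : ∀ y, ∑ Y ∈ univ.filter (fun Y : Fin (n + 1) → Γ₁ => Y p = y), k Y ≤ N) :
    ∑ X' ∈ univ.filter (fun X' : Fin (n + 1) → Γ₂' => X' p = w'), ∑ Y : Fin (n + 1) → Γ₁,
        k Y * ∑ β ∈ univ.erase β₀, ∏ i, B (X' i) β (Y i) ≤ a ^ n * τ * N := by
  -- per block `β` and in-string `Y`, the pinned out-sum is the pin entry times column sums
  have hX : ∀ (β : ι) (Y : Fin (n + 1) → Γ₁),
      ∑ X' ∈ univ.filter (fun X' : Fin (n + 1) → Γ₂' => X' p = w'), ∏ i, B (X' i) β (Y i) ≤ B w' β (Y p) * a ^ n := by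
    intro β Y
    rw [sum_pinned_prod_eq (fun i x => B x β (Y i)) p w']
    refine mul_le_mul_of_nonneg_left ?_ (hB _ _ _)
    calc ∏ i ∈ univ.erase p, ∑ x, B x β (Y i) ≤ a ^ (univ.erase p).card :=
          prod_le_pow_card_of_le _ _ (fun i _ => sum_nonneg fun x _ => hB _ _ _) fun i _ => hcol β (Y i)
      _ = a ^ n := by rw [card_univ_erase_fin]
  calc ∑ X' ∈ univ.filter (fun X' : Fin (n + 1) → Γ₂' => X' p = w'), ∑ Y : Fin (n + 1) → Γ₁,
          k Y * ∑ β ∈ univ.erase β₀, ∏ i, B (X' i) β (Y i)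
      = ∑ β ∈ univ.erase β₀, ∑ Y : Fin (n + 1) → Γ₁,
          k Y * ∑ X' ∈ univ.filter (fun X' : Fin (n + 1) → Γ₂' => X' p = w'), ∏ i, B (X' i) β (Y i) := by
        calc ∑ X' ∈ univ.filter (fun X' : Fin (n + 1) → Γ₂' => X' p = w'), ∑ Y : Fin (n + 1) → Γ₁,
                k Y * ∑ β ∈ univ.erase β₀, ∏ i, B (X' i) β (Y i)
            = ∑ X' ∈ univ.filter (fun X' : Fin (n + 1) → Γ₂' => X' p = w'), ∑ Y : Fin (n + 1) → Γ₁,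
                ∑ β ∈ univ.erase β₀, k Y * ∏ i, B (X' i) β (Y i) := by simp_rw [mul_sum]
          _ = ∑ X' ∈ univ.filter (fun X' : Fin (n + 1) → Γ₂' => X' p = w'), ∑ β ∈ univ.erase β₀, ∑ Y : Fin (n + 1) → Γ₁,
                k Y * ∏ i, B (X' i) β (Y i) := sum_congr rfl fun X' _ => sum_comm
          _ = ∑ β ∈ univ.erase β₀, ∑ X' ∈ univ.filter (fun X' : Fin (n + 1) → Γ₂' => X' p = w'), ∑ Y : Fin (n + 1) → Γ₁,
                k Y * ∏ i, B (X' i) β (Y i) := sum_comm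
          _ = ∑ β ∈ univ.erase β₀, ∑ Y : Fin (n + 1) → Γ₁, ∑ X' ∈ univ.filter (fun X' : Fin (n + 1) → Γ₂' => X' p = w'),
                k Y * ∏ i, B (X' i) β (Y i) := sum_congr rfl fun β _ => sum_comm
          _ = _ := sum_congr rfl fun β _ => sum_congr rfl fun Y _ => (mul_sum _ _ _).symm
    _ ≤ ∑ β ∈ univ.erase β₀, ∑ Y : Fin (n + 1) → Γ₁, k Y * (B w' β (Y p) * a ^ n) :=
        sum_le_sum fun β _ => sum_le_sum fun Y _ => mul_le_mul_of_nonneg_left (hX β Y) (hk Y)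
    _ = a ^ n * ∑ β ∈ univ.erase β₀, ∑ Y : Fin (n + 1) → Γ₁, k Y * B w' β (Y p) := by
        rw [mul_sum]
        refine sum_congr rfl fun β _ => ?_
        rw [mul_sum]
        exact sum_congr rfl fun Y _ => by ring
    _ ≤ a ^ n * ∑ β ∈ univ.erase β₀, (∑ y, B w' β y) * N := by
        refine mul_le_mul_of_nonneg_left (sum_le_sum fun β _ => ?_) (pow_nonneg ha n)
        exact sum_mul_apply_leg_le k (fun y => B w' β y) (fun y => hB _ _ _) p hN
    _ = a ^ n * ((∑ β ∈ univ.erase β₀, ∑ y, B w' β y) * N) := by rw [sum_mul]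
    _ ≤ a ^ n * (τ * N) := mul_le_mul_of_nonneg_left (mul_le_mul_of_nonneg_right hτ hN0) (pow_nonneg ha n)
    _ = a ^ n * τ * N := by ring

/-! ## §3 (T1): cross-block out-strings -/

omit [Fintype ι] in
/-- **(T1) CROSS-BLOCK OUT-STRINGS at a deep pin.**  If some out-leg `i ≠ p` lies outside the block `β₀` of the pin while all in-legs are lifted into `β₀`,
then either the in-leg `Y_i` is deep (its column outside the box is a tail `≤ τ`), or it is in the zone and then either the pin's own in-leg is not near
(`Σ_{¬Near} B w′ β₀ · ≤ τ`) or it is near and hence `Far` from `Y_i` (far profile `Nfar`):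
`Σ_{X′ : X′_p = w′} Σ_Y k(Y)·[X′ ⊄ β₀]·∏_i B(X′_i, β₀, Y_i) ≤ n·aⁿ·(2τN + a·Nfar)`. [folklore] -/
theorem sum_pinned_crossBlock_le {n : ℕ} (B : Γ₂' → ι → Γ₁ → ℝ) (hB : ∀ x β y, 0 ≤ B x β y) (k : (Fin (n + 1) → Γ₁) → ℝ)
    (hk : ∀ Y, 0 ≤ k Y) (p : Fin (n + 1)) (w' : Γ₂') (box : Γ₂' → ι) (β₀ : ι) (hw : box w' = β₀)
    (Z Near : Γ₁ → Prop) [DecidablePred Z] [DecidablePred Near] (Far : Γ₁ → Γ₁ → Prop) [DecidableRel Far]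
    (hZ : ∀ y y', Near y → Z y' → Far y y')
    {a τ N Nfar : ℝ} (ha : 0 ≤ a) (hτ0 : 0 ≤ τ) (hN0 : 0 ≤ N) (hNfar0 : 0 ≤ Nfar)
    (hcol : ∀ β y, ∑ x, B x β y ≤ a) (hρ : ∑ y, B w' β₀ y ≤ a)
    (hτ₁ : ∀ y, ¬ Z y → ∑ x ∈ univ.filter (fun x : Γ₂' => box x ≠ β₀), B x β₀ y ≤ τ)
    (hτ₃ : ∑ y ∈ univ.filter (fun y : Γ₁ => ¬ Near y), B w' β₀ y ≤ τ)
    (hN : ∀ y, ∑ Y ∈ univ.filter (fun Y : Fin (n + 1) → Γ₁ => Y p = y), k Y ≤ N)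
    (hNfar : ∀ y (i : Fin (n + 1)), ∑ Y ∈ univ.filter (fun Y : Fin (n + 1) → Γ₁ => Y p = y ∧ Far (Y p) (Y i)), k Y ≤ Nfar) :
    ∑ X' ∈ univ.filter (fun X' : Fin (n + 1) → Γ₂' => X' p = w'), ∑ Y : Fin (n + 1) → Γ₁,
        k Y * (if ∀ i, box (X' i) = β₀ then 0 else ∏ i, B (X' i) β₀ (Y i)) ≤ n * a ^ n * (2 * τ * N + a * Nfar) := by
  classical
  set Xp := univ.filter (fun X' : Fin (n + 1) → Γ₂' => X' p = w') with hXp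
  -- column of `y` outside the box: a tail if deep, a column otherwise
  have hcolOut : ∀ y, ∑ x ∈ univ.filter (fun x : Γ₂' => box x ≠ β₀), B x β₀ y ≤ τ + (if Z y then a else 0) := by
    intro y
    by_cases hz : Z y
    · rw [if_pos hz]
      exact ((sum_le_sum_of_subset_of_nonneg (filter_subset _ _) fun x _ _ => hB _ _ _).trans (hcol β₀ y)).trans (by linarith)
    · rw [if_neg hz, add_zero]; exact hτ₁ y hz
  -- zone indicator against the pin's in-leg: not near, or far
  have hzone : ∀ (y y' : Γ₁), (if Z y' then a else 0) ≤ (if Near y then 0 else a) + (if Far y y' then a else 0) := by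
    intro y y'
    by_cases hz : Z y'
    · rw [if_pos hz]
      by_cases hn : Near y
      · rw [if_pos hn, if_pos (hZ y y' hn hz), zero_add]
      · rw [if_neg hn]
        exact le_add_of_nonneg_right (ite_nonneg ha le_rfl)
    · rw [if_neg hz]
      exact add_nonneg (ite_nonneg le_rfl ha) (ite_nonneg ha le_rfl)
  -- Step 1: indicator ≤ sum over the offending leg `i ≠ p`
  have step1 : ∑ X' ∈ Xp, ∑ Y : Fin (n + 1) → Γ₁, k Y * (if ∀ i, box (X' i) = β₀ then 0 else ∏ i, B (X' i) β₀ (Y i)) ≤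
      ∑ i ∈ univ.erase p, ∑ Y : Fin (n + 1) → Γ₁, k Y *
        ∑ X' ∈ Xp, ∏ j, ((if j = i then (if box (X' j) = β₀ then 0 else 1) else 1) * B (X' j) β₀ (Y j)) := by
    calc ∑ X' ∈ Xp, ∑ Y : Fin (n + 1) → Γ₁, k Y * (if ∀ i, box (X' i) = β₀ then 0 else ∏ i, B (X' i) β₀ (Y i))
        ≤ ∑ X' ∈ Xp, ∑ Y : Fin (n + 1) → Γ₁, k Y *
            ∑ i ∈ univ.erase p, (if box (X' i) = β₀ then 0 else ∏ j, B (X' j) β₀ (Y j)) := by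
          refine sum_le_sum fun X' hX' => sum_le_sum fun Y _ => mul_le_mul_of_nonneg_left ?_ (hk Y)
          have hp : box (X' p) = β₀ := by rw [(mem_filter.1 hX').2, hw]
          exact ite_forall_le_sum_indicator box β₀ X' p hp (prod_nonneg fun j _ => hB _ _ _)
      _ = ∑ i ∈ univ.erase p, ∑ Y : Fin (n + 1) → Γ₁, k Y *
            ∑ X' ∈ Xp, (if box (X' i) = β₀ then 0 else ∏ j, B (X' j) β₀ (Y j)) := by
          calc ∑ X' ∈ Xp, ∑ Y : Fin (n + 1) → Γ₁, k Y *
                  ∑ i ∈ univ.erase p, (if box (X' i) = β₀ then 0 else ∏ j, B (X' j) β₀ (Y j))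
              = ∑ X' ∈ Xp, ∑ Y : Fin (n + 1) → Γ₁, ∑ i ∈ univ.erase p,
                  k Y * (if box (X' i) = β₀ then 0 else ∏ j, B (X' j) β₀ (Y j)) := by simp_rw [mul_sum]
            _ = ∑ X' ∈ Xp, ∑ i ∈ univ.erase p, ∑ Y : Fin (n + 1) → Γ₁,
                  k Y * (if box (X' i) = β₀ then 0 else ∏ j, B (X' j) β₀ (Y j)) := sum_congr rfl fun X' _ => sum_comm
            _ = ∑ i ∈ univ.erase p, ∑ X' ∈ Xp, ∑ Y : Fin (n + 1) → Γ₁,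
                  k Y * (if box (X' i) = β₀ then 0 else ∏ j, B (X' j) β₀ (Y j)) := sum_comm
            _ = ∑ i ∈ univ.erase p, ∑ Y : Fin (n + 1) → Γ₁, ∑ X' ∈ Xp,
                  k Y * (if box (X' i) = β₀ then 0 else ∏ j, B (X' j) β₀ (Y j)) := sum_congr rfl fun i _ => sum_comm
            _ = _ := sum_congr rfl fun i _ => sum_congr rfl fun Y _ => (mul_sum _ _ _).symm
      _ = _ := by
          refine sum_congr rfl fun i _ => sum_congr rfl fun Y _ => ?_
          congr 1
          refine sum_congr rfl fun X' _ => ?_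
          rw [prod_mul_distrib, Fintype.prod_ite_eq']
          split_ifs <;> simp
  -- Step 2: per leg `i ≠ p`, the pinned out-sum factorises
  have step2 : ∀ i ∈ univ.erase p, ∀ Y : Fin (n + 1) → Γ₁,
      ∑ X' ∈ Xp, ∏ j, ((if j = i then (if box (X' j) = β₀ then 0 else 1) else 1) * B (X' j) β₀ (Y j)) ≤
        B w' β₀ (Y p) * ((τ + (if Z (Y i) then a else 0)) * a ^ ((univ.erase p).erase i).card) := by
    intro i hi Y
    have hip : i ≠ p := (mem_erase.1 hi).1
    rw [hXp, sum_pinned_prod_eq (fun j x => (if j = i then (if box x = β₀ then (0 : ℝ) else 1) else 1) * B x β₀ (Y j)) p w',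
      ← mul_prod_erase (univ.erase p)
        (fun j => ∑ x, (if j = i then (if box x = β₀ then (0 : ℝ) else 1) else 1) * B x β₀ (Y j)) hi]
    simp only [if_neg hip.symm, one_mul, if_true]
    refine mul_le_mul_of_nonneg_left (mul_le_mul ?_ ?_ (prod_nonneg fun j _ => sum_nonneg fun x _ => ?_) (by positivity)) (hB _ _ _)
    · -- the offending leg: column outside the box
      calc ∑ x, (if box x = β₀ then (0 : ℝ) else 1) * B x β₀ (Y i)
          = ∑ x ∈ univ.filter (fun x : Γ₂' => box x ≠ β₀), B x β₀ (Y i) := by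
            rw [sum_filter]
            refine sum_congr rfl fun x _ => ?_
            by_cases h : box x = β₀ <;> simp [h]
        _ ≤ _ := hcolOut (Y i)
    · refine prod_le_pow_card_of_le _ _ (fun j _ => sum_nonneg fun x _ => ?_) fun j hj => ?_
      · exact mul_nonneg (by split_ifs <;> norm_num) (hB _ _ _)
      · calc ∑ x, (if j = i then (if box x = β₀ then (0 : ℝ) else 1) else 1) * B x β₀ (Y j) = ∑ x, B x β₀ (Y j) :=
              sum_congr rfl fun x _ => by rw [if_neg (mem_erase.1 hj).1, one_mul]
          _ ≤ a := hcol β₀ (Y j)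
    · exact mul_nonneg (by split_ifs <;> norm_num) (hB _ _ _)
  -- Step 3: per leg, sum over the in-strings
  have step3 : ∀ i ∈ univ.erase p,
      ∑ Y : Fin (n + 1) → Γ₁, k Y * (B w' β₀ (Y p) * ((τ + (if Z (Y i) then a else 0)) * a ^ ((univ.erase p).erase i).card)) ≤
        a ^ ((univ.erase p).erase i).card * (τ * a * N + a * τ * N + a * a * Nfar) := by
    intro i hi
    have hsplit : ∀ Y : Fin (n + 1) → Γ₁, k Y * (B w' β₀ (Y p) * ((τ + (if Z (Y i) then a else 0)) * a ^ ((univ.erase p).erase i).card)) ≤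
        a ^ ((univ.erase p).erase i).card *
          (τ * (k Y * B w' β₀ (Y p)) + (k Y * (B w' β₀ (Y p) * (if Near (Y p) then 0 else a))) +
            a * ((if Far (Y p) (Y i) then k Y else 0) * B w' β₀ (Y p))) := by
      intro Y
      have h1 := hzone (Y p) (Y i)
      have hkB : 0 ≤ k Y * B w' β₀ (Y p) := mul_nonneg (hk Y) (hB _ _ _)
      have hfar : (if Far (Y p) (Y i) then k Y else 0) * B w' β₀ (Y p) = k Y * B w' β₀ (Y p) * (if Far (Y p) (Y i) then 1 else 0) := by
        by_cases h : Far (Y p) (Y i) <;> simp [h]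
      rw [hfar]
      have : k Y * (B w' β₀ (Y p) * ((τ + (if Z (Y i) then a else 0)) * a ^ ((univ.erase p).erase i).card)) =
          a ^ ((univ.erase p).erase i).card * ((k Y * B w' β₀ (Y p)) * (τ + (if Z (Y i) then a else 0))) := by ring
      rw [this]
      refine mul_le_mul_of_nonneg_left ?_ (pow_nonneg ha _)
      have h2 : (k Y * B w' β₀ (Y p)) * (τ + (if Z (Y i) then a else 0)) ≤
          (k Y * B w' β₀ (Y p)) * (τ + ((if Near (Y p) then 0 else a) + (if Far (Y p) (Y i) then a else 0))) :=
        mul_le_mul_of_nonneg_left (add_le_add le_rfl h1) hkB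
      refine h2.trans (le_of_eq ?_)
      by_cases hn : Near (Y p) <;> by_cases hf : Far (Y p) (Y i) <;> simp [hn, hf] <;> ring
    refine (sum_le_sum fun Y _ => hsplit Y).trans ?_
    rw [← mul_sum, sum_add_distrib, sum_add_distrib, ← mul_sum, ← mul_sum]
    refine mul_le_mul_of_nonneg_left (add_le_add (add_le_add ?_ ?_) ?_) (pow_nonneg ha _)
    · -- `τ · Σ_Y k·ρ_in ≤ τ·a·N`
      rw [mul_assoc]
      refine mul_le_mul_of_nonneg_left ?_ hτ0
      exact (sum_mul_apply_leg_le k (fun y => B w' β₀ y) (fun y => hB _ _ _) p hN).trans (mul_le_mul_of_nonneg_right hρ hN0)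
    · -- not near: `Σ_Y k·ρ_in·[¬Near] ≤ τ·N·a`
      have h := sum_mul_apply_leg_le k (fun y => B w' β₀ y * (if Near y then 0 else a))
        (fun y => mul_nonneg (hB _ _ _) (by split_ifs <;> [exact le_rfl; exact ha])) p hN
      refine h.trans ?_
      have hsum : ∑ y, B w' β₀ y * (if Near y then (0 : ℝ) else a) = a * ∑ y ∈ univ.filter (fun y : Γ₁ => ¬ Near y), B w' β₀ y := by
        rw [sum_filter, mul_sum]
        exact sum_congr rfl fun y _ => by by_cases h : Near y <;> simp [h, mul_comm]
      rw [hsum]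
      exact mul_le_mul_of_nonneg_right (mul_le_mul_of_nonneg_left hτ₃ ha) hN0
    · -- far: `a · Σ_Y [far] k·ρ_in ≤ a·a·Nfar`
      rw [mul_assoc]
      refine mul_le_mul_of_nonneg_left ?_ ha
      have h := sum_mul_apply_leg_le (fun Y => if Far (Y p) (Y i) then k Y else 0) (fun y => B w' β₀ y)
        (fun y => hB _ _ _) p (N := Nfar) ?_
      · exact h.trans (mul_le_mul_of_nonneg_right hρ hNfar0)
      · intro y
        rw [← sum_filter, filter_filter]
        exact hNfar y i
  -- assemble
  refine step1.trans ?_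
  calc ∑ i ∈ univ.erase p, ∑ Y : Fin (n + 1) → Γ₁, k Y *
          ∑ X' ∈ Xp, ∏ j, ((if j = i then (if box (X' j) = β₀ then 0 else 1) else 1) * B (X' j) β₀ (Y j))
      ≤ ∑ i ∈ univ.erase p, ∑ Y : Fin (n + 1) → Γ₁,
          k Y * (B w' β₀ (Y p) * ((τ + (if Z (Y i) then a else 0)) * a ^ ((univ.erase p).erase i).card)) :=
        sum_le_sum fun i hi => sum_le_sum fun Y _ => mul_le_mul_of_nonneg_left (step2 i hi Y) (hk Y)
    _ ≤ ∑ i ∈ univ.erase p, a ^ ((univ.erase p).erase i).card * (τ * a * N + a * τ * N + a * a * Nfar) :=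
        sum_le_sum fun i hi => step3 i hi
    _ = ∑ _i ∈ univ.erase p, a ^ n * (2 * τ * N + a * Nfar) := by
        refine sum_congr rfl fun i hi => ?_
        have hc : a ^ ((univ.erase p).erase i).card * a = a ^ n := by
          rw [← pow_succ, card_univ_erase_erase_fin hi]
        rw [← hc]
        ring
    _ = n * a ^ n * (2 * τ * N + a * Nfar) := by rw [sum_const, card_univ_erase_fin, nsmul_eq_mul]; ring


end Generic

end Summit.HubbardSuperconductivity.HubbardSuperconductivity.Theorems.TwoVolumeDefect

end
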